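import Literature.MathematicalPhysics.KineticTheory.HardSphereEntranceProofs
import Literature.Analysis.FluidPDE.BoltzmannEquation
import HarnessLib

/-!
# Sphere averages of homogeneous functions as Gaussian averages

For a finite-dimensional real inner product space `E` (`dim E = d ≥ 1`), its standard Gaussian
`γ = stdGaussian E = M(v) dv` (`Literature.Analysis.FluidPDE.globalMaxwellian`) and the surface
measure `σ = volume.toSphere` on the unit sphere (`KineticTheory.sphereMeasure`), a measurable
`Φ ≥ 0` which is homogeneous of degree `k` (`Φ(r x) = rᵏ Φ(x)`, `r > 0`) satisfies, by polar
coordinates (`KineticTheory.lintegral_eq_lintegral_sphereMeasure_polar`) and the radial symmetry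
of `M`,

`∫ Φ dγ = Cₖ ∫_S Φ dσ`, `Cₖ = ∫₀^∞ r^{d-1+k} M(r) dr` (`lintegral_stdGaussian_homogeneous`);

eliminating `Cₖ` with `Φ = ‖·‖ᵏ` gives the constant-free form

`E_γ‖X‖ᵏ · ∫_S Φ dσ = σ(S) · ∫_E Φ dγ` (`moment_mul_lintegral_sphere_eq`,
real form `moment_mul_integral_sphere_eq`).

This converts the averages over impact directions `ω ∈ S^{d-1}` that occur in the linearised
Boltzmann operator into Gaussian expectations, computable by Wick's formula
(`Literature.Probability.Distributions.GaussianCoordinateMoments`).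
-/

open MeasureTheory Metric Real Set ProbabilityTheory Module
open scoped ENNReal

namespace Literature.Analysis.UnboundedOperators

noncomputable section

open Literature.MathematicalPhysics.KineticTheory (sphereMeasure lintegral_eq_lintegral_sphereMeasure_polar)
open Literature.Analysis.FluidPDE (globalMaxwellian globalMaxwellian_pos continuous_globalMaxwellian
  stdGaussian_eq_withDensity_globalMaxwellian_holds)

variable {E : Type*} [NormedAddCommGroup E] [InnerProductSpace ℝ E] [FiniteDimensional ℝ E]
  [MeasurableSpace E] [BorelSpace E]

omit [FiniteDimensional ℝ E] [MeasurableSpace E] [BorelSpace E] in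
/-- The Maxwellian is radial: `M(r ω) = (2π)^{-d/2} e^{-r²/2}` for `ω` on the unit sphere. [folklore] -/
theorem globalMaxwellian_smul_sphere (r : ℝ) (ω : sphere (0 : E) 1) :
    globalMaxwellian (r • (ω : E)) = (2 * π) ^ (-(finrank ℝ E : ℝ) / 2) * exp (-r ^ 2 / 2) := by
  rw [globalMaxwellian, norm_smul, norm_eq_of_mem_sphere ω, mul_one, Real.norm_eq_abs, sq_abs]

/-- **Gaussian integral of a homogeneous function in polar coordinates**: for measurable `Φ ≥ 0`
with `Φ(r x) = rᵏ Φ(x)` (`r > 0`) and `dim E = m + 1`,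
`∫ Φ dγ = (∫₀^∞ r^{m+k} M(r) dr) · ∫_S Φ dσ`. [folklore] -/
theorem lintegral_stdGaussian_homogeneous {m k : ℕ} (hn : finrank ℝ E = m + 1) {Φ : E → ℝ≥0∞}
    (hΦ : Measurable Φ) (hhom : ∀ r : ℝ, 0 < r → ∀ x : E, Φ (r • x) = ENNReal.ofReal (r ^ k) * Φ x) :
    ∫⁻ x, Φ x ∂stdGaussian E =
      (∫⁻ r in Ioi (0 : ℝ), ENNReal.ofReal (r ^ m * (r ^ k *
          ((2 * π) ^ (-(finrank ℝ E : ℝ) / 2) * exp (-r ^ 2 / 2))))) *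
        ∫⁻ ω : sphere (0 : E) 1, Φ ω ∂sphereMeasure := by
  have hM : Measurable fun v : E => ENNReal.ofReal (globalMaxwellian v) :=
    continuous_globalMaxwellian.measurable.ennreal_ofReal
  rw [stdGaussian_eq_withDensity_globalMaxwellian_holds, lintegral_withDensity_eq_lintegral_mul _ hM hΦ,
    lintegral_eq_lintegral_sphereMeasure_polar hn (hM.mul hΦ)]
  simp only [Pi.mul_apply]
  have hinner : ∀ ω : sphere (0 : E) 1,
      ∫⁻ r in Ioi (0 : ℝ), ENNReal.ofReal (r ^ m) *
        (ENNReal.ofReal (globalMaxwellian (r • (ω : E))) * Φ (r • (ω : E))) =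
      (∫⁻ r in Ioi (0 : ℝ), ENNReal.ofReal (r ^ m * (r ^ k *
          ((2 * π) ^ (-(finrank ℝ E : ℝ) / 2) * exp (-r ^ 2 / 2))))) * Φ ω := by
    intro ω
    rw [← lintegral_mul_const _ (by fun_prop)]
    refine setLIntegral_congr_fun measurableSet_Ioi fun r hr => ?_
    have hr' : 0 < r := hr
    rw [globalMaxwellian_smul_sphere, hhom r hr', ← mul_assoc, ← mul_assoc,
      ← ENNReal.ofReal_mul (pow_nonneg hr'.le _), ← ENNReal.ofReal_mul
        (mul_nonneg (pow_nonneg hr'.le _) (mul_nonneg (rpow_nonneg (by positivity) _) (exp_pos _).le))]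
    congr 2
    ring
  simp_rw [hinner]
  rw [lintegral_const_mul _
    (by exact hΦ.comp continuous_subtype_val.measurable : Measurable fun ω : sphere (0 : E) 1 => Φ ω)]

omit [InnerProductSpace ℝ E] [FiniteDimensional ℝ E] in
/-- The radial profile integrand is measurable. [folklore] -/
theorem measurable_norm_pow_ofReal (k : ℕ) :
    Measurable fun x : E => ENNReal.ofReal (‖x‖ ^ k) :=
  (continuous_norm.pow k).measurable.ennreal_ofReal

/-- **Sphere averages of homogeneous functions are Gaussian averages** (constant-free form):
for measurable `Φ ≥ 0` homogeneous of degree `k` and `dim E ≥ 1`,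
`E_γ‖X‖ᵏ · ∫_S Φ dσ = σ(S) · ∫_E Φ dγ`. [folklore] -/
theorem moment_mul_lintegral_sphere_eq {k : ℕ} (hE : 0 < finrank ℝ E) {Φ : E → ℝ≥0∞}
    (hΦ : Measurable Φ) (hhom : ∀ r : ℝ, 0 < r → ∀ x : E, Φ (r • x) = ENNReal.ofReal (r ^ k) * Φ x) :
    (∫⁻ x, ENNReal.ofReal (‖x‖ ^ k) ∂stdGaussian E) * ∫⁻ ω : sphere (0 : E) 1, Φ ω ∂sphereMeasure =
      sphereMeasure (univ : Set (sphere (0 : E) 1)) * ∫⁻ x, Φ x ∂stdGaussian E := by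
  obtain ⟨m, hm⟩ : ∃ m, finrank ℝ E = m + 1 := ⟨finrank ℝ E - 1, by omega⟩
  have hΨ : ∀ r : ℝ, 0 < r → ∀ x : E,
      ENNReal.ofReal (‖r • x‖ ^ k) = ENNReal.ofReal (r ^ k) * ENNReal.ofReal (‖x‖ ^ k) := by
    intro r hr x
    rw [norm_smul, Real.norm_eq_abs, abs_of_pos hr, mul_pow, ENNReal.ofReal_mul (pow_nonneg hr.le _)]
  rw [lintegral_stdGaussian_homogeneous hm hΦ hhom,
    lintegral_stdGaussian_homogeneous hm (measurable_norm_pow_ofReal (E := E) k) hΨ]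
  have h1 : ∫⁻ ω : sphere (0 : E) 1, ENNReal.ofReal (‖(ω : E)‖ ^ k) ∂sphereMeasure =
      sphereMeasure (univ : Set (sphere (0 : E) 1)) := by
    have : ∀ ω : sphere (0 : E) 1, ENNReal.ofReal (‖(ω : E)‖ ^ k) = 1 := fun ω => by
      rw [norm_eq_of_mem_sphere ω, one_pow, ENNReal.ofReal_one]
    simp_rw [this]
    rw [lintegral_const, one_mul]
  rw [h1]
  ring

/-! ### Real-valued form -/

/-- A continuous function on the unit sphere is integrable against `σ`. [folklore] -/
theorem integrable_sphere_of_continuous {Φ : E → ℝ} (hΦ : Continuous Φ) :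
    Integrable (fun ω : sphere (0 : E) 1 => Φ ω) sphereMeasure := by
  have hc : Continuous fun ω : sphere (0 : E) 1 => Φ ω := hΦ.comp continuous_subtype_val
  obtain ⟨C, hC⟩ := (isCompact_univ (X := sphere (0 : E) 1)).exists_bound_of_continuousOn
    hc.continuousOn
  exact (integrable_const C).mono' hc.aestronglyMeasurable
    (ae_of_all _ fun ω => hC ω (mem_univ ω))

/-- **Real-valued form**: for continuous `Φ ≥ 0`, homogeneous of degree `k` and `γ`-integrable,
`(∫ ‖x‖ᵏ dγ) · ∫_S Φ dσ = σ(S) · ∫_E Φ dγ`. [folklore] -/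
theorem moment_mul_integral_sphere_eq {k : ℕ} (hE : 0 < finrank ℝ E) {Φ : E → ℝ}
    (hΦc : Continuous Φ) (h0 : ∀ x, 0 ≤ Φ x) (hhom : ∀ r : ℝ, 0 < r → ∀ x : E, Φ (r • x) = r ^ k * Φ x)
    (hint : Integrable Φ (stdGaussian E))
    (hmom : Integrable (fun x : E => ‖x‖ ^ k) (stdGaussian E)) :
    (∫ x, ‖x‖ ^ k ∂stdGaussian E) * ∫ ω : sphere (0 : E) 1, Φ ω ∂sphereMeasure =
      (sphereMeasure (univ : Set (sphere (0 : E) 1))).toReal * ∫ x, Φ x ∂stdGaussian E := by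
  have h := moment_mul_lintegral_sphere_eq (k := k) hE (hΦc.measurable.ennreal_ofReal)
    (fun r hr x => by rw [hhom r hr x, ENNReal.ofReal_mul (pow_nonneg hr.le _)])
  have e1 : ∫⁻ x, ENNReal.ofReal (‖x‖ ^ k) ∂stdGaussian E = ENNReal.ofReal (∫ x, ‖x‖ ^ k ∂stdGaussian E) :=
    (ofReal_integral_eq_lintegral_ofReal hmom (ae_of_all _ fun x => by positivity)).symm
  have e2 : ∫⁻ ω : sphere (0 : E) 1, ENNReal.ofReal (Φ ω) ∂sphereMeasure =
      ENNReal.ofReal (∫ ω : sphere (0 : E) 1, Φ ω ∂sphereMeasure) :=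
    (ofReal_integral_eq_lintegral_ofReal (integrable_sphere_of_continuous hΦc)
      (ae_of_all _ fun ω => h0 ω)).symm
  have e3 : ∫⁻ x, ENNReal.ofReal (Φ x) ∂stdGaussian E = ENNReal.ofReal (∫ x, Φ x ∂stdGaussian E) :=
    (ofReal_integral_eq_lintegral_ofReal hint (ae_of_all _ fun x => h0 x)).symm
  rw [e1, e2, e3] at h
  have h' := congrArg ENNReal.toReal h
  rw [ENNReal.toReal_mul, ENNReal.toReal_mul,
    ENNReal.toReal_ofReal (integral_nonneg fun x : E => by positivity),
    ENNReal.toReal_ofReal (integral_nonneg fun ω : sphere (0 : E) 1 => h0 ω),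
    ENNReal.toReal_ofReal (integral_nonneg fun x : E => h0 x)] at h'
  exact h'

end

end Literature.Analysis.UnboundedOperators
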